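import Literature.Analysis.SingularIntegrals.MaximalTwoPointInequality
import Literature.Analysis.FunctionSpaces.TorusHolderBridge
import Literature.Analysis.FunctionSpaces.TorusConvolution
import HarnessLib

/-!
# The two-point maximal inequality on the flat torus, with an `L²` bound

Analysis/SingularIntegrals support file (everything proved; serves the discharge of the named
facts `Literature.Analysis.FluidPDE.Seis2022_rmk1_L2` / `Seis2022_thm2_L2`,
`FluidPDE/SeisDissipationRateBound`). For a `C¹` map `v : T^d → F` we produce a measurable
`Ψ : T^d → ℝ≥0∞` with

* `‖v x - v y‖ ≤ dist(x,y) (Ψ x + Ψ y)` for **all** `x, y ∈ T^d`, and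
* `∫ Ψ² ≤ C_d ∫ ‖Dv‖²`, `C_d = Torus.twoPointL2Const d < ∞`, `Ψ < ∞` everywhere

(`Torus.exists_twoPoint_maximal`): the Lusin–Lipschitz / Hajłasz inequality for smooth
functions on the torus with the sharp `H¹` control of the two-point modulus (Hajłasz 1996,
Thm. 1 with (4); Crippa–De Lellis 2008, Lemma A.3). It is obtained from the Euclidean two-point
inequality of `MaximalTwoPointInequality` applied to the periodic lift `v ∘ proj` with the
periodic size `φ(z) = ‖Dv(proj z)‖ₑ`, localised to the ball `K₀ = B(0, 3√d + 1)`: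
`Ψ x = Cₙ √d · M(φ 1_{K₀})(repr x)`. The two lifts of a pair `x, y` are taken `√d dist(x,y)`
apart (`Torus.exists_lift_norm_sub_le`), the maximal function at the lift of `y` is moved to
`repr y` by a lattice translation (`maximalFunction_comp_sub_right`, periodicity of `φ`), and
the `L²` bound is the strong type `(2,2)` of the maximal function on `ℝ^d`
(`lintegral_maximalFunction_rpow_le`) followed by the count of unit cubes covering `K₀`.

## References

* P. Hajłasz, *Sobolev spaces on an arbitrary metric space*, Potential Anal. 5 (1996),
  403–415, Thm. 1, (4).
* G. Crippa, C. De Lellis, J. reine angew. Math. 616 (2008), 15–46, Lemma A.3.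
* E. M. Stein, *Singular integrals and differentiability properties of functions* (1970),
  Ch. I §1.3 Thm. 1. [`Stein1971`]
-/

noncomputable section

open MeasureTheory MeasureTheory.Measure Metric Set Filter Function Module
open scoped ENNReal NNReal Topology
open Literature.Analysis.FunctionSpaces Literature.Analysis.FunctionSpaces.Torus

namespace Literature.Analysis.SingularIntegrals

namespace Torus

variable {d : Type*} [Fintype d]
variable {F : Type*} [NormedAddCommGroup F] [NormedSpace ℝ F]

/-! ## Translations and the maximal function -/

section Translate

variable {E : Type*} [NormedAddCommGroup E] [NormedSpace ℝ E] [FiniteDimensional ℝ E]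
  [MeasurableSpace E] [BorelSpace E] (μ : Measure E) [μ.IsAddHaarMeasure]

omit [NormedSpace ℝ E] [FiniteDimensional ℝ E] in
/-- **The maximal function commutes with translations**:
`M(G(· - w))(p) = M(G)(p - w)` (translation invariance of Haar measure and of balls). [folklore] -/
theorem maximalFunction_comp_sub_right (G : E → ℝ≥0∞) (w p : E) :
    maximalFunction μ (fun z => G (z - w)) p = maximalFunction μ G (p - w) := by
  simp only [maximalFunction_def]
  congr 1
  funext r
  congr 1
  funext hr
  have hball : μ (ball p r) = μ (ball (p - w) r) := by
    rw [addHaar_ball_center μ p r, addHaar_ball_center μ (p - w) r]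
  have hint : ∫⁻ y in ball p r, G (y - w) ∂μ = ∫⁻ y in ball (p - w) r, G y ∂μ := by
    rw [← lintegral_indicator measurableSet_ball, ← lintegral_indicator measurableSet_ball]
    have e : ∀ y, (ball p r).indicator (fun z => G (z - w)) y = (ball (p - w) r).indicator G (y - w) := by
      intro y
      by_cases hy : y ∈ ball p r
      · have hy' : y - w ∈ ball (p - w) r := by simpa [mem_ball, dist_eq_norm] using hy
        rw [indicator_of_mem hy, indicator_of_mem hy']
      · have hy' : y - w ∉ ball (p - w) r := fun h => hy (by simpa [mem_ball, dist_eq_norm] using h)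
        rw [indicator_of_notMem hy, indicator_of_notMem hy']
    simp_rw [e]
    exact lintegral_sub_right_eq_self (fun y => (ball (p - w) r).indicator G y) w
  rw [hball, hint]

end Translate

/-! ## The periodic size and its localisation -/

/-- The periodic size of a `C¹` map on the torus, `φ(z) = ‖Dv(proj z)‖ₑ = ‖D(v ∘ proj)(z)‖ₑ`. [folklore] -/
def liftSize (v : UnitAddTorus d → F) (z : EuclideanSpace ℝ d) : ℝ≥0∞ :=
  ‖Torus.fderiv v (proj z)‖ₑ

/-- `‖D(v ∘ proj)(z)‖ₑ = φ(z)`. [folklore] -/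
theorem enorm_fderiv_lift (v : UnitAddTorus d → F) (z : EuclideanSpace ℝ d) :
    ‖_root_.fderiv ℝ (lift v) z‖ₑ = liftSize v z := by
  rw [liftSize, fderiv_lift]

variable [DecidableEq d] in
/-- The periodic size is lattice periodic. [folklore] -/
theorem liftSize_add_latticeVec (v : UnitAddTorus d → F) (z : EuclideanSpace ℝ d) (k : d → ℤ) :
    liftSize v (z + latticeVec k) = liftSize v z := by
  rw [liftSize, liftSize, proj_add_latticeVec]

/-- The periodic size of a `C¹` map is continuous, hence measurable. [folklore] -/
theorem measurable_liftSize {v : UnitAddTorus d → F} (hv : IsContDiff 1 v) : Measurable (liftSize v) :=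
  (hv.continuous_fderiv.comp continuous_proj).measurable.enorm

/-- The periodic size of a `C¹` map is bounded. [folklore] -/
theorem exists_liftSize_le {v : UnitAddTorus d → F} (hv : IsContDiff 1 v) :
    ∃ C : ℝ, ∀ z, liftSize v z ≤ ENNReal.ofReal C := by
  obtain ⟨C, hC⟩ := exists_forall_norm_le_of_continuous hv.continuous_fderiv
  exact ⟨C, fun z => by rw [liftSize, ← ofReal_norm]; exact ENNReal.ofReal_le_ofReal (hC _)⟩

/-- The localisation radius `R₀ = 3√d + 1`. [folklore] -/
def locRadius (d : Type*) [Fintype d] : ℝ := 3 * Real.sqrt (Fintype.card d) + 1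

/-- The localised size `φ 1_{B(0, R₀)}`. [folklore] -/
def locSize (v : UnitAddTorus d → F) : EuclideanSpace ℝ d → ℝ≥0∞ :=
  (ball (0 : EuclideanSpace ℝ d) (locRadius d)).indicator (liftSize v)

/-- Points of the unit cube have norm `≤ √d`. [folklore] -/
theorem norm_le_sqrt_card_of_mem_unitCube {a : EuclideanSpace ℝ d} (ha : a ∈ unitCube d) :
    ‖a‖ ≤ Real.sqrt (Fintype.card d) := by
  rw [EuclideanSpace.norm_eq]
  refine Real.sqrt_le_sqrt ?_
  calc ∑ i, ‖a i‖ ^ 2 ≤ ∑ _i : d, (1 : ℝ) := Finset.sum_le_sum fun i _ => by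
        have h := (mem_unitCube.1 ha) i
        rw [Real.norm_eq_abs, abs_of_nonneg h.1]
        nlinarith [h.1, h.2]
    _ = Fintype.card d := by simp

/-- `‖repr x‖ ≤ √d`. [folklore] -/
theorem norm_repr_le (x : UnitAddTorus d) : ‖repr x‖ ≤ Real.sqrt (Fintype.card d) :=
  norm_le_sqrt_card_of_mem_unitCube (repr_mem_unitCube x)

/-- A ball of radius `3r`, `r ≤ √d/2`, around a point of norm `≤ √d` lies in `B(0, R₀)`. [folklore] -/
theorem ball_subset_ball_locRadius {p : EuclideanSpace ℝ d} (hp : ‖p‖ ≤ Real.sqrt (Fintype.card d))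
    {r : ℝ} (hr : r ≤ Real.sqrt (Fintype.card d) / 2) :
    ball p (3 * r) ⊆ ball (0 : EuclideanSpace ℝ d) (locRadius d) := by
  intro z hz
  rw [mem_ball, dist_zero_right]
  rw [mem_ball, dist_eq_norm] at hz
  calc ‖z‖ = ‖(z - p) + p‖ := by rw [sub_add_cancel]
    _ ≤ ‖z - p‖ + ‖p‖ := norm_add_le _ _
    _ < 3 * r + Real.sqrt (Fintype.card d) := add_lt_add_of_lt_of_le hz hp
    _ ≤ locRadius d := by
        have h0 := Real.sqrt_nonneg (Fintype.card d : ℝ)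
        unfold locRadius; linarith

/-- Localised maximal functions on small balls are dominated by `M(φ 1_{B(0,R₀)})`. [folklore] -/
theorem maximalFunction_indicator_ball_le_locSize (v : UnitAddTorus d → F) {p : EuclideanSpace ℝ d}
    (hp : ‖p‖ ≤ Real.sqrt (Fintype.card d)) {r : ℝ} (hr : r ≤ Real.sqrt (Fintype.card d) / 2)
    (q : EuclideanSpace ℝ d) :
    maximalFunction volume ((ball p (3 * r)).indicator (liftSize v)) q ≤
      maximalFunction volume (locSize v) q :=
  maximalFunction_mono volume
    (fun y => indicator_le_indicator_of_subset (ball_subset_ball_locRadius hp hr) (fun _ => bot_le) y) q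

/-! ## The two-point inequality on the torus -/

/-- The pointwise constant `Cₙ √d` (`n = d`). [folklore] -/
def twoPointTorusConst (d : Type*) [Fintype d] : ℝ :=
  twoPointConst (Fintype.card d) * Real.sqrt (Fintype.card d)

/-- `0 ≤ Cₙ √d`. [folklore] -/
theorem twoPointTorusConst_nonneg (d : Type*) [Fintype d] : 0 ≤ twoPointTorusConst d :=
  mul_nonneg (twoPointConst_nonneg _) (Real.sqrt_nonneg _)

/-- The candidate `Ψ x = Cₙ √d · M(φ 1_{B(0,R₀)})(repr x)`. [folklore] -/
def twoPointFun (v : UnitAddTorus d → F) (x : UnitAddTorus d) : ℝ≥0∞ :=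
  ENNReal.ofReal (twoPointTorusConst d) * maximalFunction volume (locSize v) (repr x)

/-- `Ψ` is measurable. [folklore] -/
theorem measurable_twoPointFun (v : UnitAddTorus d → F) : Measurable (twoPointFun v) :=
  ((measurable_maximalFunction volume _).comp measurable_repr).const_mul _

/-- `Ψ` is finite everywhere (the size is bounded). [folklore] -/
theorem twoPointFun_lt_top {v : UnitAddTorus d → F} (hv : IsContDiff 1 v) (x : UnitAddTorus d) :
    twoPointFun v x < ∞ := by
  obtain ⟨C, hC⟩ := exists_liftSize_le hv
  refine ENNReal.mul_lt_top ENNReal.ofReal_lt_top ?_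
  refine lt_of_le_of_lt (maximalFunction_le_of_ae_le volume (c := ENNReal.ofReal C)
    (Eventually.of_forall fun y => ?_) _) ENNReal.ofReal_lt_top
  exact (indicator_le_self _ _ y).trans (hC y)

/-- **The two-point maximal inequality on `T^d`** (pointwise part): for a `C¹` map `v` and all
`x, y`, `‖v x - v y‖ₑ ≤ dist(x,y) (Ψ x + Ψ y)`. [folklore] -/
theorem enorm_sub_le_dist_mul_twoPointFun [CompleteSpace F] {v : UnitAddTorus d → F} (hv : IsContDiff 1 v)
    (x y : UnitAddTorus d) :
    ‖v x - v y‖ₑ ≤ ENNReal.ofReal (dist x y) * (twoPointFun v x + twoPointFun v y) := by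
  classical
  -- lifts `a = repr x`, `b` with `proj b = y`, `‖a - b‖ ≤ √d dist x y`
  obtain ⟨a', b', ha', hb', hab'⟩ := exists_lift_norm_sub_le x y
  set a : EuclideanSpace ℝ d := repr x with ha
  set b : EuclideanSpace ℝ d := b' + (a - a') with hb
  have hpa : proj a = x := proj_repr x
  have hpb : proj b = y := by rw [hb, proj_add, hb', proj_sub, hpa, ha', sub_self, add_zero]
  have hab : ‖a - b‖ ≤ Real.sqrt (Fintype.card d) * dist x y := by
    have e : a - b = a' - b' := by rw [hb]; abel
    rwa [e]
  have hdist : dist a b ≤ Real.sqrt (Fintype.card d) * dist x y := by rwa [dist_eq_norm]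
  have hr : dist a b ≤ Real.sqrt (Fintype.card d) / 2 :=
    hdist.trans (by nlinarith [dist_le_half x y, Real.sqrt_nonneg (Fintype.card d : ℝ)])
  -- the Euclidean two-point inequality for the lift
  have hg : ContDiff ℝ 1 (lift v) := hv
  have h2 := enorm_sub_le_mul_maximalFunction_add volume hg (measurable_liftSize hv)
    (fun w => (enorm_fderiv_lift v w).le) a b
  rw [lift_apply, lift_apply, hpa, hpb] at h2
  -- the `a`-term
  have hMa : maximalFunction volume ((ball a (3 * dist a b)).indicator (liftSize v)) a ≤
      maximalFunction volume (locSize v) (repr x) :=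
    maximalFunction_indicator_ball_le_locSize v (norm_repr_le x) hr a
  -- the `b`-term: move to `repr y` by the lattice vector `b - repr y`
  obtain ⟨k, hk⟩ : ∃ k : d → ℤ, b = repr y + latticeVec k :=
    (proj_eq_proj_iff_holds (repr y) b).1 (by rw [proj_repr, hpb])
  have hMb : maximalFunction volume ((ball b (3 * dist a b)).indicator (liftSize v)) b ≤
      maximalFunction volume (locSize v) (repr y) := by
    have hfun : (ball b (3 * dist a b)).indicator (liftSize v) =
        fun z => (ball (repr y) (3 * dist a b)).indicator (liftSize v) (z - latticeVec k) := by
      funext z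
      by_cases hz : z ∈ ball b (3 * dist a b)
      · have hz' : z - latticeVec k ∈ ball (repr y) (3 * dist a b) := by
          rw [mem_ball, dist_eq_norm] at hz ⊢
          convert hz using 2
          rw [hk]; abel
        rw [indicator_of_mem hz, indicator_of_mem hz']
        conv_lhs => rw [← sub_add_cancel z (latticeVec k)]
        rw [liftSize_add_latticeVec]
      · have hz' : z - latticeVec k ∉ ball (repr y) (3 * dist a b) := fun h => hz (by
          rw [mem_ball, dist_eq_norm] at h ⊢
          convert h using 2
          rw [hk]; abel)
        rw [indicator_of_notMem hz, indicator_of_notMem hz']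
    have hbk : b - latticeVec k = repr y := by rw [hk, add_sub_cancel_right]
    rw [hfun, maximalFunction_comp_sub_right, hbk]
    exact maximalFunction_indicator_ball_le_locSize v (norm_repr_le y) hr _
  -- constants
  have hC : ENNReal.ofReal (twoPointConst (finrank ℝ (EuclideanSpace ℝ d)) * dist a b) ≤
      ENNReal.ofReal (dist x y) * ENNReal.ofReal (twoPointTorusConst d) := by
    rw [← ENNReal.ofReal_mul dist_nonneg, finrank_euclideanSpace]
    refine ENNReal.ofReal_le_ofReal ?_
    calc twoPointConst (Fintype.card d) * dist a b
        ≤ twoPointConst (Fintype.card d) * (Real.sqrt (Fintype.card d) * dist x y) :=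
          mul_le_mul_of_nonneg_left hdist (twoPointConst_nonneg _)
      _ = dist x y * twoPointTorusConst d := by unfold twoPointTorusConst; ring
  calc ‖v x - v y‖ₑ ≤ _ := h2
    _ ≤ (ENNReal.ofReal (dist x y) * ENNReal.ofReal (twoPointTorusConst d)) *
          (maximalFunction volume (locSize v) (repr x) + maximalFunction volume (locSize v) (repr y)) :=
        mul_le_mul' hC (add_le_add hMa hMb)
    _ = ENNReal.ofReal (dist x y) * (twoPointFun v x + twoPointFun v y) := by
        simp only [twoPointFun]; ring

/-! ## The `L²` bound -/

/-- The strong-type-`(2,2)` constant of the maximal function in dimension `n` (the constant of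
`lintegral_maximalFunction_rpow_le` at `p = 2`). [folklore] -/
def maximalL2Const (n : ℕ) : ℝ≥0∞ :=
  ENNReal.ofReal 2 * (2 * 5 ^ n) * ((2 : ℝ≥0∞) ^ ((2 : ℝ) - 1) / ENNReal.ofReal ((2 : ℝ) - 1))

/-- The maximal constant is finite. [folklore] -/
theorem maximalL2Const_lt_top (n : ℕ) : maximalL2Const n < ∞ :=
  maximalLpConst_lt_top n one_lt_two

/-- The lattice range `m = ⌈R₀⌉₊ + 1` of unit cubes needed to cover `B(0, R₀)`. [folklore] -/
def coverRange (d : Type*) [Fintype d] : ℕ := ⌈locRadius d⌉₊ + 1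

/-- The finite set of lattice points `{k : |kᵢ| ≤ m}`. [folklore] -/
def coverLattice (d : Type*) [Fintype d] [DecidableEq d] : Finset (d → ℤ) :=
  Fintype.piFinset fun _ => Finset.Icc (-(coverRange d : ℤ)) (coverRange d)

/-- The `L²` constant `C_d = (Cₙ √d)² · C_HL · #coverLattice`. [folklore] -/
def twoPointL2Const (d : Type*) [Fintype d] [DecidableEq d] : ℝ≥0∞ :=
  ENNReal.ofReal (twoPointTorusConst d) ^ 2 * maximalL2Const (Fintype.card d) * (coverLattice d).card

/-- `C_d < ∞`. [folklore] -/
theorem twoPointL2Const_lt_top (d : Type*) [Fintype d] [DecidableEq d] : twoPointL2Const d < ∞ :=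
  ENNReal.mul_lt_top (ENNReal.mul_lt_top (ENNReal.pow_lt_top ENNReal.ofReal_lt_top)
    (maximalL2Const_lt_top _)) (ENNReal.natCast_lt_top _)

variable [DecidableEq d] in
/-- **Covering `B(0, R₀)` by lattice translates of the unit cube**: every `z` with `‖z‖ < R₀`
lies in `latticeVec k + [0,1)^d` for `k = ⌊z⌋ ∈ coverLattice`. [folklore] -/
theorem exists_mem_coverLattice_sub_mem_unitCube {z : EuclideanSpace ℝ d}
    (hz : z ∈ ball (0 : EuclideanSpace ℝ d) (locRadius d)) :
    ∃ k ∈ coverLattice d, z - latticeVec k ∈ unitCube d := by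
  rw [mem_ball, dist_zero_right] at hz
  refine ⟨fun i => ⌊z i⌋, ?_, ?_⟩
  · rw [coverLattice, Fintype.mem_piFinset]
    intro i
    rw [Finset.mem_Icc]
    have hzi : |z i| < locRadius d := lt_of_le_of_lt (by simpa using abs_apply_le_norm z i) hz
    have hR : locRadius d ≤ (⌈locRadius d⌉₊ : ℝ) := Nat.le_ceil _
    have hm : ((coverRange d : ℤ) : ℝ) = (⌈locRadius d⌉₊ : ℝ) + 1 := by simp [coverRange]
    rw [abs_lt] at hzi
    constructor
    · have h1 : ((-(coverRange d : ℤ) : ℤ) : ℝ) < ((⌊z i⌋ : ℤ) : ℝ) := by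
        have := Int.sub_one_lt_floor (z i)
        push_cast [hm] at this ⊢
        linarith
      exact_mod_cast h1.le
    · have h1 : ((⌊z i⌋ : ℤ) : ℝ) ≤ ((coverRange d : ℤ) : ℝ) := by
        have := Int.floor_le (z i)
        rw [hm]
        linarith
      exact_mod_cast h1
  · rw [mem_unitCube]
    intro i
    rw [PiLp.sub_apply, latticeVec_apply]
    exact ⟨Int.fract_nonneg _, Int.fract_lt_one _⟩

variable [DecidableEq d] in
/-- The translate `{z | z - latticeVec k ∈ [0,1)^d}` carries the same `φ²`-mass as the cube
(translation invariance and periodicity). [folklore] -/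
theorem lintegral_indicator_translate_liftSize_sq (v : UnitAddTorus d → F) (k : d → ℤ) :
    ∫⁻ z, {z : EuclideanSpace ℝ d | z - latticeVec k ∈ unitCube d}.indicator (fun z => liftSize v z ^ 2) z =
      ∫⁻ z in unitCube d, liftSize v z ^ 2 := by
  have e : ∀ z, {z : EuclideanSpace ℝ d | z - latticeVec k ∈ unitCube d}.indicator (fun z => liftSize v z ^ 2) z =
      (unitCube d).indicator (fun z => liftSize v z ^ 2) (z - latticeVec k) := by
    intro z
    have hper : liftSize v z = liftSize v (z - latticeVec k) := by
      conv_lhs => rw [← sub_add_cancel z (latticeVec k)]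
      rw [liftSize_add_latticeVec]
    by_cases hz : z - latticeVec k ∈ unitCube d
    · rw [indicator_of_mem (show z ∈ {z : EuclideanSpace ℝ d | z - latticeVec k ∈ unitCube d} from hz),
        indicator_of_mem hz, hper]
    · rw [indicator_of_notMem (show z ∉ {z : EuclideanSpace ℝ d | z - latticeVec k ∈ unitCube d} from hz),
        indicator_of_notMem hz]
  simp_rw [e]
  rw [lintegral_sub_right_eq_self (fun z => (unitCube d).indicator (fun z => liftSize v z ^ 2) z) (latticeVec k),
    lintegral_indicator measurableSet_unitCube]

/-- The cube carries the torus enstrophy: `∫_{[0,1)^d} φ² = ∫_{T^d} ‖Dv‖²`. [folklore] -/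
theorem setLIntegral_unitCube_liftSize_sq {v : UnitAddTorus d → F} (hv : IsContDiff 1 v) :
    ∫⁻ z in unitCube d, liftSize v z ^ 2 = ∫⁻ x, ‖Torus.fderiv v x‖ₑ ^ 2 := by
  have hg : Measurable fun x : UnitAddTorus d => ‖Torus.fderiv v x‖ₑ ^ 2 :=
    hv.continuous_fderiv.measurable.enorm.pow_const 2
  exact (measurePreserving_proj_unitCube_holds (d := d)).lintegral_comp hg

variable [DecidableEq d] in
/-- **The localised size has `L²`-mass at most `#coverLattice` torus enstrophies**:
`∫_{ℝ^d} (φ 1_{B(0,R₀)})² ≤ #coverLattice · ∫_{T^d} ‖Dv‖²`. [folklore] -/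
theorem lintegral_locSize_sq_le {v : UnitAddTorus d → F} (hv : IsContDiff 1 v) :
    ∫⁻ z, locSize v z ^ 2 ≤ (coverLattice d).card * ∫⁻ x, ‖Torus.fderiv v x‖ₑ ^ 2 := by
  set T : (d → ℤ) → Set (EuclideanSpace ℝ d) := fun k => {z | z - latticeVec k ∈ unitCube d} with hT
  have hcov : ball (0 : EuclideanSpace ℝ d) (locRadius d) ⊆ ⋃ k : coverLattice d, T k := by
    intro z hz
    obtain ⟨k, hk, hzk⟩ := exists_mem_coverLattice_sub_mem_unitCube hz
    exact mem_iUnion.2 ⟨⟨k, hk⟩, hzk⟩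
  have e1 : ∫⁻ z, locSize v z ^ 2 = ∫⁻ z in ball (0 : EuclideanSpace ℝ d) (locRadius d), liftSize v z ^ 2 := by
    rw [← lintegral_indicator measurableSet_ball]
    refine lintegral_congr fun z => ?_
    simp only [locSize]
    by_cases hz : z ∈ ball (0 : EuclideanSpace ℝ d) (locRadius d)
    · rw [indicator_of_mem hz, indicator_of_mem hz]
    · rw [indicator_of_notMem hz, indicator_of_notMem hz, zero_pow two_ne_zero]
  rw [e1]
  calc ∫⁻ z in ball (0 : EuclideanSpace ℝ d) (locRadius d), liftSize v z ^ 2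
      ≤ ∫⁻ z in ⋃ k : coverLattice d, T k, liftSize v z ^ 2 := lintegral_mono_set hcov
    _ ≤ ∑' k : coverLattice d, ∫⁻ z in T k, liftSize v z ^ 2 := lintegral_iUnion_le _ _
    _ = ∑ k : coverLattice d, ∫⁻ z in T k, liftSize v z ^ 2 := tsum_fintype _
    _ = ∑ _k : coverLattice d, ∫⁻ x, ‖Torus.fderiv v x‖ₑ ^ 2 := by
        refine Finset.sum_congr rfl fun k _ => ?_
        have hTm : MeasurableSet (T k) := measurableSet_unitCube.preimage (measurable_id.sub measurable_const)
        rw [← lintegral_indicator hTm, lintegral_indicator_translate_liftSize_sq,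
          setLIntegral_unitCube_liftSize_sq hv]
    _ = (coverLattice d).card * ∫⁻ x, ‖Torus.fderiv v x‖ₑ ^ 2 := by
        rw [Finset.sum_const, Finset.card_univ, Fintype.card_coe, nsmul_eq_mul]

variable [DecidableEq d] in
/-- **The `L²` bound of the two-point inequality on `T^d`**: `∫ Ψ² ≤ C_d ∫ ‖Dv‖²`
(strong type `(2,2)` of the maximal function on `ℝ^d` and the cube count). [folklore] -/
theorem lintegral_twoPointFun_sq_le {v : UnitAddTorus d → F} (hv : IsContDiff 1 v) :
    ∫⁻ x, twoPointFun v x ^ 2 ≤ twoPointL2Const d * ∫⁻ x, ‖Torus.fderiv v x‖ₑ ^ 2 := by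
  have hSm : Measurable (locSize v) := (measurable_liftSize hv).indicator measurableSet_ball
  have hMm : Measurable fun a => maximalFunction volume (locSize v) a ^ 2 :=
    (measurable_maximalFunction volume _).pow_const 2
  have hMr : Measurable fun x : UnitAddTorus d => maximalFunction volume (locSize v) (repr x) ^ 2 :=
    hMm.comp measurable_repr
  -- Step 1: pull the constant and transport along `repr`
  have e1 : ∫⁻ x, twoPointFun v x ^ 2 = ENNReal.ofReal (twoPointTorusConst d) ^ 2 *
      ∫⁻ x : UnitAddTorus d, maximalFunction volume (locSize v) (repr x) ^ 2 := by
    simp only [twoPointFun, mul_pow]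
    exact lintegral_const_mul _ hMr
  have e2 : ∫⁻ x : UnitAddTorus d, maximalFunction volume (locSize v) (repr x) ^ 2 =
      ∫⁻ a in unitCube d, maximalFunction volume (locSize v) a ^ 2 :=
    (measurePreserving_repr (d := d)).lintegral_comp hMm
  -- Step 2: the maximal theorem on `ℝ^d`
  have h3 : ∫⁻ a, maximalFunction volume (locSize v) a ^ 2 ≤
      maximalL2Const (Fintype.card d) * ∫⁻ z, locSize v z ^ 2 := by
    have h := lintegral_maximalFunction_rpow_le volume hSm.aemeasurable (one_lt_two : (1 : ℝ) < 2)
    simp only [ENNReal.rpow_two, finrank_euclideanSpace] at h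
    exact h
  calc ∫⁻ x, twoPointFun v x ^ 2
      = ENNReal.ofReal (twoPointTorusConst d) ^ 2 * ∫⁻ a in unitCube d, maximalFunction volume (locSize v) a ^ 2 := by
        rw [e1, e2]
    _ ≤ ENNReal.ofReal (twoPointTorusConst d) ^ 2 * ∫⁻ a, maximalFunction volume (locSize v) a ^ 2 :=
        mul_le_mul' le_rfl (lintegral_mono' Measure.restrict_le_self le_rfl)
    _ ≤ ENNReal.ofReal (twoPointTorusConst d) ^ 2 * (maximalL2Const (Fintype.card d) * ∫⁻ z, locSize v z ^ 2) :=
        mul_le_mul' le_rfl h3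
    _ ≤ ENNReal.ofReal (twoPointTorusConst d) ^ 2 * (maximalL2Const (Fintype.card d) *
          ((coverLattice d).card * ∫⁻ x, ‖Torus.fderiv v x‖ₑ ^ 2)) :=
        mul_le_mul' le_rfl (mul_le_mul' le_rfl (lintegral_locSize_sq_le hv))
    _ = twoPointL2Const d * ∫⁻ x, ‖Torus.fderiv v x‖ₑ ^ 2 := by
        simp only [twoPointL2Const]; ring

/-- **The two-point maximal inequality on the torus, packaged.** For a `C¹` map
`v : T^d → F` there is a measurable, everywhere finite `Ψ : T^d → [0,∞]` with
`‖v x - v y‖ ≤ dist(x,y) (Ψ x + Ψ y)` for all `x, y` and `∫ Ψ² ≤ C_d ∫ ‖Dv‖²`, `C_d < ∞`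
(Hajłasz 1996, Thm. 1 / (4) for smooth functions, with the explicit `H¹` control). [folklore] -/
theorem exists_twoPoint_maximal [CompleteSpace F] [DecidableEq d] {v : UnitAddTorus d → F}
    (hv : IsContDiff 1 v) :
    ∃ Ψ : UnitAddTorus d → ℝ≥0∞, Measurable Ψ ∧ (∀ x, Ψ x < ∞) ∧
      (∀ x y, ‖v x - v y‖ₑ ≤ ENNReal.ofReal (dist x y) * (Ψ x + Ψ y)) ∧
      ∫⁻ x, Ψ x ^ 2 ≤ twoPointL2Const d * ∫⁻ x, ‖Torus.fderiv v x‖ₑ ^ 2 :=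
  ⟨twoPointFun v, measurable_twoPointFun v, twoPointFun_lt_top hv,
    enorm_sub_le_dist_mul_twoPointFun hv, lintegral_twoPointFun_sq_le hv⟩

end Torus

end Literature.Analysis.SingularIntegrals
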